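import Summits.Ventures.DiscreteObjects.UnitDistance.FrameEmbedding
import Summits.Ventures.DiscreteObjects.UnitDistance.MultiquadraticTwoThree

/-!
# U2-COMPLETE: the 2-adic criterion for real multiquadratic planes (cell `pub-namedobj`, target (U), seat udg g11)

Framing (verbatim for the cell): lottery ticket; floor = certified bounds/negative ranges.

Let `S ⊂ ℕ` be finite and `K_S = ℚ(√d : d ∈ S) ⊂ ℝ` (`multiSqrtField S`).  The 2-adic square class of `d` is read off
`d mod 8` (odd `d`) or `d mod 16` (`d ≡ 2 mod 4`); the subgroup the classes generate avoids `[−1]` iff all of them lie in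
ONE of the four maximal `[−1]`-free subgroups of `ℚ₂^×/ℚ₂^{×2} = ⟨[−1],[2],[5]⟩`:

| pattern | classes | `d mod 8` (odd) | `d mod 16` (even) | bound | file |
|---|---|---|---|---|---|
| `⟨[2],[3]⟩`  | `1,2,3,6`   | `1, 3` | `2, 6`   | `χ ≤ 4` | `MultiquadraticTwoThree` (udg g10) |
| `⟨[−2],[3]⟩` | `1,3,10,14` | `1, 3` | `10, 14` | `χ ≤ 4` | `colorable_four_of_multiSqrtField_m23` |
| `⟨[2],[5]⟩`  | `1,2,5,10`  | `1, 5` | `2, 10`  | `χ ≤ 2` | `colorable_two_of_multiSqrtField_25` |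
| `⟨[−2],[5]⟩` | `1,5,6,14`  | `1, 5` | `6, 14`  | `χ ≤ 2` | `colorable_two_of_multiSqrtField_m25` |

THEOREM (Prop U2 of the cell, sufficient half, COMPLETE; PROP-U2.md udg g3 2026-08-20, refereed on paper): in all four
cases every unit-distance graph with coordinates in `K_S` is `4`-colourable (`colorable_four_of_squareClasses`), and in
the last two (the classes also avoid `[3]`: `K_S(i)/K_S` ramified at `2`) it is BIPARTITE (`colorable_two_of_squareClasses`).
Printed special cases reproduced: Woodall 1973 `χ(ℚ²) = 2`; Johnson 1987 `χ(ℚ(√n)²) = 2`, `n ≡ 1, 2 (mod 4)`; Fischer 1990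
`χ(ℚ(√n)²) ≤ 4`, `n ≡ 3 (mod 8)`; Madore 2015 Prop. 3.6 `χ(ℚ₂(√2)²) = 2` (all quadratic; [Payne 2009, arXiv:0707.1177 p. 6];
Soifer 2009 Open Problem 11.6).  The multiquadratic statements were not found in print (Fischer, Congr. Numer. 72 (1990),
on the components of `ℚ(√N₁,…,√N_d)²`, unread) — novelty PROVISIONAL; formalisation (spectral norm on `\overline{ℚ₂}`,
Galois sign frames, no residue field named) is the cell's.  Nothing here is literature.
-/

noncomputable section

namespace Summit.Ventures.DiscreteObjects.UnitDistance

open MoserLocal SimpleGraph IntermediateField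
open scoped IntermediateField

/-! ## Square roots in the three new frames -/

/-- Pattern `⟨[−2],[3]⟩`: `d ≡ 1, 3 (mod 8)` or `d ≡ 10, 14 (mod 16)` ⇒ `√d ∈ ℚ₂(s2·I, s3)`. -/
theorem exists_sq_eq_framem23 (D : FullLocalData Ω₂) (d : ℕ)
    (hd : d % 8 = 1 ∨ d % 8 = 3 ∨ d % 16 = 10 ∨ d % 16 = 14) :
    ∃ w ∈ ℚ_[2]⟮D.framem23.g₁, D.framem23.g₂⟯, w ^ 2 = (d : Ω₂) := by
  refine exists_sq_eq_in_frame D.g₁_sq.2.2.1 D.framem23.g₂_sq (by change (3 : ℚ_[2]) ≠ 0; norm_num) d ?_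
  change ∃ m : ℤ, m % 8 = 1 ∧ ((d : ℚ_[2]) = m ∨ (d : ℚ_[2]) * 3 = m ∨ (d : ℚ_[2]) = m * (-2) ∨ (d : ℚ_[2]) * 3 = m * (-2))
  rcases hd with h1 | h3 | h10 | h14
  · exact ⟨d, by omega, Or.inl (by push_cast; ring)⟩
  · exact ⟨3 * d, by omega, Or.inr (Or.inl (by push_cast; ring))⟩
  · obtain ⟨k, rfl⟩ : ∃ k, d = 2 * k := ⟨d / 2, by omega⟩
    exact ⟨-(3 * k), by omega, Or.inr (Or.inr (Or.inr (by push_cast; ring)))⟩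
  · obtain ⟨k, rfl⟩ : ∃ k, d = 2 * k := ⟨d / 2, by omega⟩
    exact ⟨-k, by omega, Or.inr (Or.inr (Or.inl (by push_cast; ring)))⟩

/-- Pattern `⟨[2],[5]⟩`: `d ≡ 1, 5 (mod 8)` or `d ≡ 2, 10 (mod 16)` ⇒ `√d ∈ ℚ₂(s2, s3·I)`. -/
theorem exists_sq_eq_frame2m3 (D : FullLocalData Ω₂) (d : ℕ)
    (hd : d % 8 = 1 ∨ d % 8 = 5 ∨ d % 16 = 2 ∨ d % 16 = 10) :
    ∃ w ∈ ℚ_[2]⟮D.frame2m3.g₁, D.frame2m3.g₂⟯, w ^ 2 = (d : Ω₂) := by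
  refine exists_sq_eq_in_frame D.g₁_sq.2.1 D.frame2m3.g₂_sq (by change (-3 : ℚ_[2]) ≠ 0; norm_num) d ?_
  change ∃ m : ℤ, m % 8 = 1 ∧ ((d : ℚ_[2]) = m ∨ (d : ℚ_[2]) * (-3) = m ∨ (d : ℚ_[2]) = m * 2 ∨ (d : ℚ_[2]) * (-3) = m * 2)
  rcases hd with h1 | h5 | h2 | h10
  · exact ⟨d, by omega, Or.inl (by push_cast; ring)⟩
  · exact ⟨-(3 * d), by omega, Or.inr (Or.inl (by push_cast; ring))⟩
  · obtain ⟨k, rfl⟩ : ∃ k, d = 2 * k := ⟨d / 2, by omega⟩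
    exact ⟨k, by omega, Or.inr (Or.inr (Or.inl (by push_cast; ring)))⟩
  · obtain ⟨k, rfl⟩ : ∃ k, d = 2 * k := ⟨d / 2, by omega⟩
    exact ⟨-(3 * k), by omega, Or.inr (Or.inr (Or.inr (by push_cast; ring)))⟩

/-- Pattern `⟨[−2],[5]⟩`: `d ≡ 1, 5 (mod 8)` or `d ≡ 6, 14 (mod 16)` ⇒ `√d ∈ ℚ₂(s2·I, s3·I)`. -/
theorem exists_sq_eq_framem2m3 (D : FullLocalData Ω₂) (d : ℕ)
    (hd : d % 8 = 1 ∨ d % 8 = 5 ∨ d % 16 = 6 ∨ d % 16 = 14) :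
    ∃ w ∈ ℚ_[2]⟮D.framem2m3.g₁, D.framem2m3.g₂⟯, w ^ 2 = (d : Ω₂) := by
  refine exists_sq_eq_in_frame D.g₁_sq.2.2.2 D.framem2m3.g₂_sq (by change (-3 : ℚ_[2]) ≠ 0; norm_num) d ?_
  change ∃ m : ℤ, m % 8 = 1 ∧
    ((d : ℚ_[2]) = m ∨ (d : ℚ_[2]) * (-3) = m ∨ (d : ℚ_[2]) = m * (-2) ∨ (d : ℚ_[2]) * (-3) = m * (-2))
  rcases hd with h1 | h5 | h6 | h14
  · exact ⟨d, by omega, Or.inl (by push_cast; ring)⟩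
  · exact ⟨-(3 * d), by omega, Or.inr (Or.inl (by push_cast; ring))⟩
  · obtain ⟨k, rfl⟩ : ∃ k, d = 2 * k := ⟨d / 2, by omega⟩
    exact ⟨3 * k, by omega, Or.inr (Or.inr (Or.inr (by push_cast; ring)))⟩
  · obtain ⟨k, rfl⟩ : ∃ k, d = 2 * k := ⟨d / 2, by omega⟩
    exact ⟨-k, by omega, Or.inr (Or.inr (Or.inl (by push_cast; ring)))⟩

/-! ## The three new colouring theorems -/

/-- PATTERN `⟨[−2],[3]⟩` (FOUR COLOURS): if every `d ∈ S` is `≡ 1, 3 (mod 8)` or `≡ 10, 14 (mod 16)`, every graph with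
`ℚ(√d : d ∈ S)`-coordinates and unit-quadrance edges is `4`-colourable.  E.g. `ℚ(√3, √11, √14)`, `ℚ(√10, √19, √30)`. -/
theorem colorable_four_of_multiSqrtField_m23 (S : Finset ℕ)
    (hS : ∀ d ∈ S, d % 8 = 1 ∨ d % 8 = 3 ∨ d % 16 = 10 ∨ d % 16 = 14)
    {V : Type*} {G : SimpleGraph V} (x y : V → multiSqrtField S)
    (hadj : ∀ ⦃v w : V⦄, G.Adj v w → (x v - x w) ^ 2 + (y v - y w) ^ 2 = 1) : G.Colorable 4 :=
  colorable_four_of_embedding_frame (multiSqrtField S) fullLocalData₂.framem23 fullLocalData₂.g₁_sq.2.2.1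
    (multiSqrtEmbed S : multiSqrtField S →ₐ[ℚ] Ω₂).toRingHom
    (fun t => multiSqrtEmbed_mem_of_roots S (multiSqrtEmbed S) _
      (fun d hd => exists_sq_eq_framem23 fullLocalData₂ d (hS d hd)) t) x y hadj

/-- PATTERN `⟨[2],[5]⟩` (TWO COLOURS): if every `d ∈ S` is `≡ 1, 5 (mod 8)` or `≡ 2, 10 (mod 16)`, every graph with
`ℚ(√d : d ∈ S)`-coordinates and unit-quadrance edges is BIPARTITE.  E.g. `ℚ(√2)`, `ℚ(√5)`, `ℚ(√10)`, `ℚ(√2, √5, √13, √17)`. -/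
theorem colorable_two_of_multiSqrtField_25 (S : Finset ℕ)
    (hS : ∀ d ∈ S, d % 8 = 1 ∨ d % 8 = 5 ∨ d % 16 = 2 ∨ d % 16 = 10)
    {V : Type*} {G : SimpleGraph V} (x y : V → multiSqrtField S)
    (hadj : ∀ ⦃v w : V⦄, G.Adj v w → (x v - x w) ^ 2 + (y v - y w) ^ 2 = 1) : G.Colorable 2 :=
  colorable_two_of_embedding_frame (multiSqrtField S) fullLocalData₂.frame2m3 rfl fullLocalData₂.g₁_sq.2.1
    (multiSqrtEmbed S : multiSqrtField S →ₐ[ℚ] Ω₂).toRingHom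
    (fun t => multiSqrtEmbed_mem_of_roots S (multiSqrtEmbed S) _
      (fun d hd => exists_sq_eq_frame2m3 fullLocalData₂ d (hS d hd)) t) x y hadj

/-- PATTERN `⟨[−2],[5]⟩` (TWO COLOURS): if every `d ∈ S` is `≡ 1, 5 (mod 8)` or `≡ 6, 14 (mod 16)`, every graph with
`ℚ(√d : d ∈ S)`-coordinates and unit-quadrance edges is BIPARTITE.  E.g. `ℚ(√6)`, `ℚ(√14)`, `ℚ(√5, √6, √13, √14, √30)`. -/
theorem colorable_two_of_multiSqrtField_m25 (S : Finset ℕ)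
    (hS : ∀ d ∈ S, d % 8 = 1 ∨ d % 8 = 5 ∨ d % 16 = 6 ∨ d % 16 = 14)
    {V : Type*} {G : SimpleGraph V} (x y : V → multiSqrtField S)
    (hadj : ∀ ⦃v w : V⦄, G.Adj v w → (x v - x w) ^ 2 + (y v - y w) ^ 2 = 1) : G.Colorable 2 :=
  colorable_two_of_embedding_frame (multiSqrtField S) fullLocalData₂.framem2m3 rfl fullLocalData₂.g₁_sq.2.2.2
    (multiSqrtEmbed S : multiSqrtField S →ₐ[ℚ] Ω₂).toRingHom
    (fun t => multiSqrtEmbed_mem_of_roots S (multiSqrtEmbed S) _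
      (fun d hd => exists_sq_eq_framem2m3 fullLocalData₂ d (hS d hd)) t) x y hadj

/-! ## THE CRITERION -/

/-- The four square-class patterns of a finite `S ⊂ ℕ` (the generated subgroup of `ℚ₂^×/ℚ₂^{×2}` avoids `[−1]`). -/
def SquareClassesAvoidNegOne (S : Finset ℕ) : Prop :=
  (∀ d ∈ S, d % 8 = 1 ∨ d % 8 = 3 ∨ d % 16 = 2 ∨ d % 16 = 6) ∨
  (∀ d ∈ S, d % 8 = 1 ∨ d % 8 = 3 ∨ d % 16 = 10 ∨ d % 16 = 14) ∨
  (∀ d ∈ S, d % 8 = 1 ∨ d % 8 = 5 ∨ d % 16 = 2 ∨ d % 16 = 10) ∨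
  (∀ d ∈ S, d % 8 = 1 ∨ d % 8 = 5 ∨ d % 16 = 6 ∨ d % 16 = 14)

/-- The two RAMIFIED patterns (the generated subgroup avoids `[−1]` and `[3]`). -/
def SquareClassesAvoidNegOneAndThree (S : Finset ℕ) : Prop :=
  (∀ d ∈ S, d % 8 = 1 ∨ d % 8 = 5 ∨ d % 16 = 2 ∨ d % 16 = 10) ∨
  (∀ d ∈ S, d % 8 = 1 ∨ d % 8 = 5 ∨ d % 16 = 6 ∨ d % 16 = 14)

/-- The four patterns are decidable (`decide` for concrete `S`). -/
instance (S : Finset ℕ) : Decidable (SquareClassesAvoidNegOne S) := by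
  unfold SquareClassesAvoidNegOne; infer_instance

/-- The two ramified patterns are decidable. -/
instance (S : Finset ℕ) : Decidable (SquareClassesAvoidNegOneAndThree S) := by
  unfold SquareClassesAvoidNegOneAndThree; infer_instance

/-- The ramified patterns are among the four. -/
theorem SquareClassesAvoidNegOneAndThree.avoidNegOne {S : Finset ℕ} (h : SquareClassesAvoidNegOneAndThree S) :
    SquareClassesAvoidNegOne S := by
  rcases h with h | h
  · exact Or.inr (Or.inr (Or.inl h))
  · exact Or.inr (Or.inr (Or.inr h))

/-- THEOREM U2 (sufficient half, complete; kernel).  If the 2-adic square classes of `S` avoid `[−1]` (one of the four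
patterns), every graph with `ℚ(√d : d ∈ S)`-coordinates and unit-quadrance edges is `4`-colourable. -/
theorem colorable_four_of_squareClasses (S : Finset ℕ) (hS : SquareClassesAvoidNegOne S)
    {V : Type*} {G : SimpleGraph V} (x y : V → multiSqrtField S)
    (hadj : ∀ ⦃v w : V⦄, G.Adj v w → (x v - x w) ^ 2 + (y v - y w) ^ 2 = 1) : G.Colorable 4 := by
  rcases hS with h | h | h | h
  · exact colorable_four_of_multiSqrtField₂₃ S h x y hadj
  · exact colorable_four_of_multiSqrtField_m23 S h x y hadj
  · exact (colorable_two_of_multiSqrtField_25 S h x y hadj).mono (by norm_num)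
  · exact (colorable_two_of_multiSqrtField_m25 S h x y hadj).mono (by norm_num)

/-- THEOREM U2, BIPARTITE CLAUSE (kernel).  If the 2-adic square classes of `S` avoid `[−1]` and `[3]` (one of the two
ramified patterns), every graph with `ℚ(√d : d ∈ S)`-coordinates and unit-quadrance edges is `2`-colourable. -/
theorem colorable_two_of_squareClasses (S : Finset ℕ) (hS : SquareClassesAvoidNegOneAndThree S)
    {V : Type*} {G : SimpleGraph V} (x y : V → multiSqrtField S)
    (hadj : ∀ ⦃v w : V⦄, G.Adj v w → (x v - x w) ^ 2 + (y v - y w) ^ 2 = 1) : G.Colorable 2 := by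
  rcases hS with h | h
  · exact colorable_two_of_multiSqrtField_25 S h x y hadj
  · exact colorable_two_of_multiSqrtField_m25 S h x y hadj

/-- Realisation form of THEOREM U2: a unit-distance graph in the Euclidean plane with all coordinates in
`ℚ(√d : d ∈ S)`, `S` in one of the four patterns, is `4`-colourable. -/
theorem colorable_four_of_realisation_in_squareClasses (S : Finset ℕ) (hS : SquareClassesAvoidNegOne S)
    {V : Type*} {G : SimpleGraph V} {p : V → EuclideanSpace ℝ (Fin 2)} (hp : IsUnitDistanceRealisation G p)
    (hK : ∀ v i, p v i ∈ multiSqrtField S) : G.Colorable 4 := by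
  refine colorable_four_of_squareClasses S hS (G := G) (fun v => ⟨p v 0, hK v 0⟩) (fun v => ⟨p v 1, hK v 1⟩) ?_
  intro v w hvw
  apply Subtype.ext
  push_cast
  exact sq_add_sq_eq_one_of_dist_eq_one (hp.2 hvw)

/-- Realisation form of the bipartite clause: all coordinates in `ℚ(√d : d ∈ S)`, `S` ramified ⇒ BIPARTITE. -/
theorem colorable_two_of_realisation_in_squareClasses (S : Finset ℕ) (hS : SquareClassesAvoidNegOneAndThree S)
    {V : Type*} {G : SimpleGraph V} {p : V → EuclideanSpace ℝ (Fin 2)} (hp : IsUnitDistanceRealisation G p)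
    (hK : ∀ v i, p v i ∈ multiSqrtField S) : G.Colorable 2 := by
  refine colorable_two_of_squareClasses S hS (G := G) (fun v => ⟨p v 0, hK v 0⟩) (fun v => ⟨p v 1, hK v 1⟩) ?_
  intro v w hvw
  apply Subtype.ext
  push_cast
  exact sq_add_sq_eq_one_of_dist_eq_one (hp.2 hvw)

/-- Census consequence: a unit-distance graph that is NOT `4`-colourable (every 5-chromatic one, any 6-chromatic witness
of target (U)) has a coordinate outside `ℚ(√d : d ∈ S)` for EVERY `S` of the four patterns; one that is not bipartite
(e.g. contains a triangle or a Moser spindle) has a coordinate outside every ramified `ℚ(√d : d ∈ S)`. -/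
theorem leaves_squareClass_fields {V : Type*} {G : SimpleGraph V} {p : V → EuclideanSpace ℝ (Fin 2)}
    (hp : IsUnitDistanceRealisation G p) :
    (¬ G.Colorable 4 → ∀ S : Finset ℕ, SquareClassesAvoidNegOne S → ∃ v i, p v i ∉ multiSqrtField S) ∧
    (¬ G.Colorable 2 → ∀ S : Finset ℕ, SquareClassesAvoidNegOneAndThree S → ∃ v i, p v i ∉ multiSqrtField S) := by
  constructor
  · intro h4 S hS
    by_contra hall
    push Not at hall
    exact h4 (colorable_four_of_realisation_in_squareClasses S hS hp hall)
  · intro h2 S hS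
    by_contra hall
    push Not at hall
    exact h2 (colorable_two_of_realisation_in_squareClasses S hS hp hall)

/-! ## Chromatic numbers: `χ(K_S²) = 2` in the ramified patterns -/

/-- `χ(K_S²) = 2` (algebraic form) for every ramified pattern: the unit-quadrance graph of `ℚ(√d : d ∈ S)` has chromatic
number exactly `2`.  E.g. `S = {2}` (Madore 2015 Prop. 3.6 / Johnson 1987), `{5}`, `{6}`, `{10}`, `{14}`, `{2, 5, 13, 17}`,
`{5, 6, 13, 14, 30}`; `S = ∅` is Woodall 1973 (`χ(ℚ²) = 2`, see `RationalPlane`). -/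
theorem chromaticNumber_unitCircleGraph_eq_two (S : Finset ℕ) (hS : SquareClassesAvoidNegOneAndThree S) :
    (unitCircleGraph (multiSqrtField S)).chromaticNumber = 2 := by
  rw [show (2 : ℕ∞) = (1 : ℕ) + 1 by norm_num]
  exact chromaticNumber_eq_iff_colorable_not_colorable.mpr
    ⟨colorable_two_of_squareClasses S hS (G := unitCircleGraph (multiSqrtField S)) Prod.fst Prod.snd fun _ _ h => h.2,
      not_colorable_one_unitCircleGraph _⟩

/-- `χ(K_S²) ≤ 4` (algebraic form) for all four patterns. -/
theorem colorable_four_unitCircleGraph_of_squareClasses (S : Finset ℕ) (hS : SquareClassesAvoidNegOne S) :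
    (unitCircleGraph (multiSqrtField S)).Colorable 4 :=
  colorable_four_of_squareClasses S hS (G := unitCircleGraph (multiSqrtField S)) Prod.fst Prod.snd fun _ _ h => h.2

/-- JOHNSON 1987 in the kernel (and without the square-free hypothesis): `χ(ℚ(√n)²) = 2` for every `n ≡ 1, 2 (mod 4)`. -/
theorem chromaticNumber_unitCircleGraph_quadratic_eq_two (n : ℕ) (hn : n % 4 = 1 ∨ n % 4 = 2) :
    (unitCircleGraph (multiSqrtField {n})).chromaticNumber = 2 := by
  apply chromaticNumber_unitCircleGraph_eq_two
  unfold SquareClassesAvoidNegOneAndThree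
  simp only [Finset.mem_singleton, forall_eq]
  omega

/-- FISCHER 1990 in the kernel (the `2`-adic case): `χ(ℚ(√n)²) ≤ 4` for every `n ≡ 3 (mod 8)` (an instance of udg g10's
`MoserMultiquadratic`; e.g. `n = 3, 11, 19, 35, 43`). -/
theorem colorable_four_unitCircleGraph_quadratic (n : ℕ) (hn : n % 8 = 3) :
    (unitCircleGraph (multiSqrtField {n})).Colorable 4 :=
  colorable_four_unitCircleGraph_multiSqrtField {n} (by simpa using Or.inr hn)

/-- Examples beyond print: bipartite multiquadratic planes. -/
example : (unitCircleGraph (multiSqrtField {2, 5, 13, 17, 26})).chromaticNumber = 2 :=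
  chromaticNumber_unitCircleGraph_eq_two _ (by decide)

example : (unitCircleGraph (multiSqrtField {5, 6, 13, 14, 21, 30})).chromaticNumber = 2 :=
  chromaticNumber_unitCircleGraph_eq_two _ (by decide)

example : (unitCircleGraph (multiSqrtField {3, 10, 11, 14, 19})).Colorable 4 :=
  colorable_four_unitCircleGraph_of_squareClasses _ (by decide)

end Summit.Ventures.DiscreteObjects.UnitDistance
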